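import Literature.NumberTheory.EllipticCurves.Kato2004.IwasawaH1Reduction
import Literature.NumberTheory.EllipticCurves.IwasawaTwistModPShapiroCores
import Literature.NumberTheory.GaloisRepresentations.ContinuousCorestrictionComp
import HarnessLib

/-!
# Kato 2004 §13.8 / §12.2, the `Ω`-adic class of an element of `𝐇¹_Γ(T_pW)`: from the
# norm-compatible reductions `(red_n x)_n ∈ lim←_n H¹(ℚ_n, W[p])` to the compatible family
# `(Sh_J⁻¹)` of the `T`-adic tower `𝐇¹_Ω = lim←_J H¹(ℚ, 𝒯_J)` (definitions + proofs; no fact)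

Topic `NumberTheory/EllipticCurves`, sub-directory `Kato2004`.  Cell `bsd-smallim` (rung K6 of
`BirchSwinnertonDyer`, crux `MuTransferX9` = item 19276, open stub `stub_coreX9` of skeleton v4
`0154dd5daf38efd6`), seat `bsd-smallim-k6-ty` (typer), CORE-PLAN S0.4 in the currency of k6-c2's
`ZpExtension.twistTower` (`IwasawaTwistModPTower.lean`): the GLUE of
`Kato2004/IwasawaH1Reduction.lean` (`IwasawaH1Data.red : 𝐇¹_Γ(T_pW) → lim←_n H¹(ℚ_n, W[p])`, the
pin's currency) with `IwasawaTwistModPShapiroCores.lean` (`coresShapiro n = Sh_n⁻¹ : H¹(ℚ_n, M) →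
H¹(ℚ, 𝒯_{p^n})`, cores ↔ truncation).

* `coresLe_eq_of_layerCores_eq` — a family `(y_n)_n` of `H¹(ℚ_n, M)` with `Cor y_{n+1} = y_n`
  (`Kato2004.layerCores`) satisfies `Cor_{ℚ_{n'} → ℚ_n} y_{n'} = y_n` for all `n < n'` (transitivity
  of the transfer, `coresLe_comp`).
* **`towerOfNormCompatible T hM κ y hy : κ.twistTower T hM`** — the compatible family
  `J ↦ trunc_{J ← p^J} (Sh_J⁻¹ y_J)` of `∏_J H¹(ℚ, 𝒯_J)` attached to a norm-compatible family `y`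
  (compatibility: `truncH1_truncH1`, `truncH1_coresShapiro_of_le`, and the previous lemma);
  `towerOfNormCompatible_apply_pow` (its `p^n`-th component is `Sh_n⁻¹ y_n`) and
  `towerOfNormCompatible_eq_zero_iff` (it vanishes iff every `y_n` does — `coresShapiro` is
  bijective).
* **`IwasawaH1Data.redTower I : I.H →+ κ.twistTower (W.torsionGaloisModule p) _`** — the `Ω`-adic
  class `x ↦ (trunc (Sh⁻¹ (red_J (proj J x))))_J` of an element of the pinned `𝐇¹_Γ(T_pW)`
  (`𝐳̄₁ := image of 𝐳₁` of MU-TRANSFER-PROOF Step 0), `redTower_eq_zero_iff : I.redTower x = 0 ↔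
  I.red x = 0`, and, under the named fact `mem_pSmul_of_red_eq_zero` (Kato §13.8 "`𝐇¹(T)/p𝐇¹(T) ⊂
  H¹(ℤ[1/p], T ⊗ Λ/pΛ)`"), `redTower_ne_zero_of_not_mem : s ∉ (p)•𝐇¹ ⟹ I.redTower s ≠ 0` and
  `redTower_eq_zero_iff_mem` — exactly the input "`𝐳̄₁ ≠ 0` in `𝐇¹_Ω`" of the stub from its
  hypothesis `s ∉ (augIdealP p) • ⊤`.

## References

* K. Kato, Astérisque 295 (2004), §12.2 (p. 220: "the inverse limit is taken with respect to trace
  maps"), §13.8 (pp. 228–229: "`𝐇^q(T) = lim←_n H^q(ℤ[1/p], T ⊗ O_λ[G_n])`",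
  "`𝐇¹(T)/x𝐇¹(T) ⊂ H¹(ℤ[1/p], T ⊗ Λ/xΛ)`"). [Kato2004Asterisque]
* J.-P. Serre, *Galois Cohomology* (1997), I §2.5. [SerreGaloisCohomology1997]
* B. Mazur, K. Rubin, *Kolyvagin systems* (2004), §5.3. [MazurRubin2004]
-/

noncomputable section

open scoped NumberField
open Field CategoryTheory
open Literature.NumberTheory.GaloisRepresentations
open Literature.NumberTheory.EllipticCurves Literature.NumberTheory.EllipticCurves.Kato2004
open Literature.NumberTheory.EllipticCurves.Kato2004.EulerSystemValues
open WeierstrassCurve (geomPoints geomTorsion)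

universe u

namespace Literature.NumberTheory.EllipticCurves.Kato2004

/-! ## From norm-compatible families to the `T`-adic tower (any `p`-torsion discrete module) -/

section General

variable {M : Type} [AddCommGroup M] [TopologicalSpace M] [DiscreteTopology M]
  (T : DiscreteGaloisModule ℚ M) {p : ℕ} [Fact p.Prime] (hM : ∀ x : M, p • x = 0)
  (κ : ZpExtension ℚ p)

/-- `Γ_n = Gal(ℚ̄/ℚ_n)` has finite index `p^n` in `Γ_ℚ` (`ZpExtension.index_layerSubgroup`).
[folklore] -/
private theorem finiteIndex_layer (n : ℕ) : (κ.layerSubgroup n).FiniteIndex :=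
  ⟨by rw [κ.index_layerSubgroup n]; exact pow_ne_zero _ (Fact.out : p.Prime).ne_zero⟩

/-- A `Fintype` structure on `Γ_n ⧸ Γ_{n'}` (finite: `Γ_{n'}` has finite index in `Γ_ℚ`), feeding the
instance binders of `coresLe` / `coresLe_comp`. [cite: Kato2004Asterisque, §12.2 (p. 220)] -/
@[reducible] def fintypeLayerQuotient (n n' : ℕ) :
    Fintype (κ.layerSubgroup n ⧸ (κ.layerSubgroup n').subgroupOf (κ.layerSubgroup n)) :=
  haveI := finiteIndex_layer κ n'
  Fintype.ofFinite _

/-- `J ≤ p^J`. [folklore] -/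
private theorem le_pow_self' (J : ℕ) : J ≤ p ^ J := (Nat.lt_pow_self (Fact.out : p.Prime).one_lt).le

/-- **Iterated trace compatibility.**  If `Cor_{ℚ_{n+1} → ℚ_n} y_{n+1} = y_n` for all `n`
(`Kato2004.layerCores`), then `Cor_{ℚ_{n'} → ℚ_n} y_{n'} = y_n` for all `n < n'`, for ANY finiteness
structure on `Γ_n ⧸ Γ_{n'}` (transitivity of corestriction, `coresLe_comp`; Kato §12.2 "the inverse
limit is taken with respect to trace maps"). [cite: Kato2004Asterisque, §12.2 (p. 220)]
[cite: NeukirchSchmidtWingberg2008, Prop. 1.5.3] -/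
theorem coresLe_eq_of_layerCores_eq (y : ∀ n : ℕ, H1 T (κ.layerSubgroup n))
    (hy : ∀ n, layerCores T κ n (y (n + 1)) = y n) {n n' : ℕ} (h : n < n')
    [hF : Fintype (κ.layerSubgroup n ⧸ (κ.layerSubgroup n').subgroupOf (κ.layerSubgroup n))] :
    coresLe T.toTopRep (κ.layerSubgroup_antitone h.le) (κ.isOpen_layerSubgroup n') (y n') = y n := by
  obtain ⟨k, rfl⟩ := Nat.exists_eq_add_of_lt h
  induction k generalizing hF with
  | zero =>
    have h1 := hy n
    unfold layerCores at h1
    convert h1 using 3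
    rfl
  | succ k ih =>
    haveI hF1 := fintypeLayerQuotient κ n (n + k + 1)
    haveI hF2 := fintypeLayerQuotient κ (n + k + 1) (n + (k + 1) + 1)
    have hstep : coresLe T.toTopRep (κ.layerSubgroup_antitone (Nat.le_succ (n + k + 1)))
        (κ.isOpen_layerSubgroup (n + (k + 1) + 1)) (y (n + (k + 1) + 1)) = y (n + k + 1) := by
      have h1 := hy (n + k + 1)
      unfold layerCores at h1
      convert h1 using 3
      · rfl
      · omega
    have hcomp := congrArg (fun f => f (y (n + (k + 1) + 1)))
      (coresLe_comp T.toTopRep (H := κ.layerSubgroup (n + (k + 1) + 1))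
        (H' := κ.layerSubgroup (n + k + 1)) (H'' := κ.layerSubgroup n)
        (κ.layerSubgroup_antitone (Nat.le_succ (n + k + 1)))
        (κ.layerSubgroup_antitone (Nat.lt_add_of_pos_right k.succ_pos).le)
        (κ.isOpen_layerSubgroup _) (κ.isOpen_layerSubgroup _))
    simp only [LinearMap.coe_comp, Function.comp_apply] at hcomp
    rw [hstep, ih (Nat.lt_add_of_pos_right k.succ_pos)] at hcomp
    convert hcomp.symm using 3

/-- **The compatible family of the `T`-adic tower attached to a norm-compatible family**:
`J ↦ trunc_{J ← p^J} (Sh_J⁻¹ y_J) ∈ H¹(ℚ, 𝒯_J)`, where `Sh_J⁻¹ = coresShapiro J : H¹(ℚ_J, M) →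
H¹(ℚ, 𝒯_{p^J})` is the inverse Shapiro map (corestriction after `m ↦ m·T⁰`) and `J ≤ p^J`.
Compatibility under truncation: `truncH1_truncH1`, cores ↔ truncation (`truncH1_coresShapiro_of_le`)
and `coresLe_eq_of_layerCores_eq`.  This is Kato's identification
`𝐇¹(T/p) = lim←_n H¹(ℤ[ζ_{p^n}, 1/p], T/p) = lim←_n H¹(ℤ[1/p], T/p ⊗ 𝔽_p[G_n])` read in the
`T`-adic tower of k6-c2 (`ZpExtension.twistTower`).
[cite: Kato2004Asterisque, §13.8 (p. 228)] [cite: SerreGaloisCohomology1997, I §2.5 Prop. 10] -/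
def towerOfNormCompatible (y : ∀ n : ℕ, H1 T (κ.layerSubgroup n))
    (hy : ∀ n, layerCores T κ n (y (n + 1)) = y n) : κ.twistTower T hM :=
  ⟨fun J ↦ κ.truncH1 T hM (le_pow_self' J)
      (haveI := κ.fintypeQuotientLayer J; κ.coresShapiro T hM J (y J)), by
    intro J J' h
    letI := κ.fintypeQuotientLayer J
    letI := κ.fintypeQuotientLayer J'
    rcases h.eq_or_lt with rfl | hlt
    · exact κ.truncH1_refl T hM _ _
    · letI := fintypeLayerQuotient κ J' J
      change κ.truncH1 T hM h (κ.truncH1 T hM (le_pow_self' J) (κ.coresShapiro T hM J (y J))) =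
        κ.truncH1 T hM (le_pow_self' J') (κ.coresShapiro T hM J' (y J'))
      rw [κ.truncH1_truncH1 T hM,
        ← κ.truncH1_truncH1 T hM (Nat.pow_le_pow_right (Fact.out : p.Prime).pos hlt.le)
          (le_pow_self' J'),
        κ.truncH1_coresShapiro_of_le T hM hlt.le,
        coresLe_eq_of_layerCores_eq T κ y hy hlt]⟩

/-- The `J`-th component of `towerOfNormCompatible`: `trunc_{J ← p^J} (coresShapiro J y_J)`.
[cite: Kato2004Asterisque, §13.8 (p. 228)] -/
theorem towerOfNormCompatible_apply (y : ∀ n : ℕ, H1 T (κ.layerSubgroup n))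
    (hy : ∀ n, layerCores T κ n (y (n + 1)) = y n) (J : ℕ) :
    (towerOfNormCompatible T hM κ y hy : ∀ J : ℕ, galoisCohomology (κ.twistModP T hM J) 1) J =
      κ.truncH1 T hM (le_pow_self' J)
        (haveI := κ.fintypeQuotientLayer J; κ.coresShapiro T hM J (y J)) := rfl

/-- **The `p^n`-th component is `Sh_n⁻¹ y_n`**: `(towerOfNormCompatible y)_{p^n} = coresShapiro n y_n`
in `H¹(ℚ, 𝒯_{p^n})` (cores ↔ truncation from level `p^n` down to `n`).
[cite: Kato2004Asterisque, §13.8 (p. 228)] [cite: SerreGaloisCohomology1997, I §2.5 (b)] -/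
theorem towerOfNormCompatible_apply_pow (y : ∀ n : ℕ, H1 T (κ.layerSubgroup n))
    (hy : ∀ n, layerCores T κ n (y (n + 1)) = y n) (n : ℕ) :
    (towerOfNormCompatible T hM κ y hy : ∀ J : ℕ, galoisCohomology (κ.twistModP T hM J) 1) (p ^ n) =
      (haveI := κ.fintypeQuotientLayer n; κ.coresShapiro T hM n (y n)) := by
  letI := κ.fintypeQuotientLayer n
  letI := κ.fintypeQuotientLayer (p ^ n)
  letI := fintypeLayerQuotient κ n (p ^ n)
  have hlt : n < p ^ n := Nat.lt_pow_self (Fact.out : p.Prime).one_lt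
  rw [towerOfNormCompatible_apply, κ.truncH1_coresShapiro_of_le T hM hlt.le,
    coresLe_eq_of_layerCores_eq T κ y hy hlt]

/-- **`towerOfNormCompatible y = 0 ↔ y = 0`**: the `Ω`-adic class of a norm-compatible family
vanishes iff the family does (`⇐` trivial; `⇒`: its `p^n`-th component is `Sh_n⁻¹ y_n` and `Sh_n⁻¹`
is injective, `coresShapiro_eq_zero_iff`). [cite: SerreGaloisCohomology1997, I §2.5 Prop. 10] -/
theorem towerOfNormCompatible_eq_zero_iff (y : ∀ n : ℕ, H1 T (κ.layerSubgroup n))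
    (hy : ∀ n, layerCores T κ n (y (n + 1)) = y n) :
    towerOfNormCompatible T hM κ y hy = 0 ↔ y = 0 := by
  constructor
  · intro h0
    funext n
    letI := κ.fintypeQuotientLayer n
    have hc := congrArg
      (fun x : κ.twistTower T hM ↦ (x : ∀ J : ℕ, galoisCohomology (κ.twistModP T hM J) 1) (p ^ n)) h0
    rw [towerOfNormCompatible_apply_pow] at hc
    exact (κ.coresShapiro_eq_zero_iff T hM n (y n)).1 hc
  · rintro rfl
    refine Subtype.ext (funext fun J ↦ ?_)
    letI := κ.fintypeQuotientLayer J
    rw [towerOfNormCompatible_apply]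
    change κ.truncH1 T hM _ (κ.coresShapiro T hM J 0) = 0
    rw [map_zero, map_zero]

end General

/-! ## The `Ω`-adic class of an element of the pinned `𝐇¹_Γ(T_pW)` -/

namespace IwasawaH1Data

variable {W : WeierstrassCurve ℚ} [W.IsElliptic] {p : ℕ} [Fact p.Prime]
  [ContinuousSMul ℤ_[p] (W.tateModule p)] {κ : ZpExtension ℚ p} {γ : absoluteGaloisGroup ℚ}
  (I : IwasawaH1Data W p κ γ)

omit [W.IsElliptic] [Fact p.Prime] [ContinuousSMul ℤ_[p] (W.tateModule p)] in
/-- `W[p]` is killed by `p` (the hypothesis `hM` of the twists `𝒯_J(E)`, as in `W.modPTwist`).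
[cite: Washington1997, §13.1–§13.2] -/
theorem torsion_nsmul_eq_zero (P : geomTorsion W (p : ℤ)) : p • P = 0 :=
  AddSubgroup.torsionBy.nsmul P

/-- **The `Ω`-adic class `red_Ω : 𝐇¹_Γ(T_pW) → 𝐇¹_Ω = lim←_J H¹(ℚ, 𝒯_J(E))`** of MU-TRANSFER-PROOF
Step 0 (`𝐳₁ ↦ 𝐳̄₁`): reduce modulo `p` levelwise (`I.red`, a norm-compatible family of
`∏_n H¹(ℚ_n, W[p])`), then pass to the `T`-adic tower through the inverse Shapiro maps
(`towerOfNormCompatible`).  Additive. [cite: Kato2004Asterisque, §13.8 (pp. 228–229)] -/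
def redTower : I.H →+ κ.twistTower (W.torsionGaloisModule (p : ℤ)) torsion_nsmul_eq_zero where
  toFun x := towerOfNormCompatible (W.torsionGaloisModule (p : ℤ)) torsion_nsmul_eq_zero κ (I.red x)
    (fun n ↦ (I.isNormCompatible_red x).2 n)
  map_zero' := by
    rw [towerOfNormCompatible_eq_zero_iff]
    exact map_zero _
  map_add' x x' := by
    refine Subtype.ext (funext fun J ↦ ?_)
    rw [AddSubgroup.coe_add, Pi.add_apply, towerOfNormCompatible_apply, towerOfNormCompatible_apply,
      towerOfNormCompatible_apply, ← map_add, ← map_add, map_add, Pi.add_apply]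

/-- Components of `redTower`: `(red_Ω x)_J = trunc_{J ← p^J} (Sh_J⁻¹ (red_J (proj J x)))`.
[cite: Kato2004Asterisque, §13.8 (p. 228)] -/
theorem redTower_apply_coe (x : I.H) (J : ℕ) :
    (I.redTower x : ∀ J : ℕ, galoisCohomology (κ.twistModP (W.torsionGaloisModule (p : ℤ))
      torsion_nsmul_eq_zero J) 1) J =
      κ.truncH1 (W.torsionGaloisModule (p : ℤ)) torsion_nsmul_eq_zero (le_pow_self' J)
        (haveI := κ.fintypeQuotientLayer J;
          κ.coresShapiro (W.torsionGaloisModule (p : ℤ)) torsion_nsmul_eq_zero J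
            (reduceH1 W p (κ.layerSubgroup J) (I.proj J x))) := rfl

/-- The `p^n`-th component of `red_Ω x` is `Sh_n⁻¹ (red_n (proj n x))`.
[cite: Kato2004Asterisque, §13.8 (p. 228)] [cite: SerreGaloisCohomology1997, I §2.5 (b)] -/
theorem redTower_apply_coe_pow (x : I.H) (n : ℕ) :
    (I.redTower x : ∀ J : ℕ, galoisCohomology (κ.twistModP (W.torsionGaloisModule (p : ℤ))
      torsion_nsmul_eq_zero J) 1) (p ^ n) =
      (haveI := κ.fintypeQuotientLayer n;
        κ.coresShapiro (W.torsionGaloisModule (p : ℤ)) torsion_nsmul_eq_zero n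
          (reduceH1 W p (κ.layerSubgroup n) (I.proj n x))) :=
  towerOfNormCompatible_apply_pow _ _ κ _ (fun n ↦ (I.isNormCompatible_red x).2 n) n

/-- **`red_Ω x = 0 ↔ red x = 0`** (the inverse Shapiro maps are injective).
[cite: SerreGaloisCohomology1997, I §2.5 Prop. 10] -/
theorem redTower_eq_zero_iff (x : I.H) : I.redTower x = 0 ↔ I.red x = 0 :=
  towerOfNormCompatible_eq_zero_iff _ _ κ _ (fun n ↦ (I.isNormCompatible_red x).2 n)

/-- `(p) • 𝐇¹ ⊆ ker red_Ω` (PROVED: `red_eq_zero_of_mem`). [cite: Kato2004Asterisque, §13.8 (p. 228)] -/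
theorem redTower_eq_zero_of_mem {x : I.H}
    (hx : x ∈ (IwasawaAlgebra.augIdealP p) • (⊤ : Submodule (IwasawaAlgebra p) I.H)) :
    I.redTower x = 0 :=
  (I.redTower_eq_zero_iff x).2 (I.red_eq_zero_of_mem hx)

/-- **MU-TRANSFER-PROOF Step 0, `𝐳̄₁ ≠ 0`**: under Kato's `𝐇¹(T)/p𝐇¹(T) ⊂ 𝐇¹(T/p)` (the named fact
`mem_pSmul_of_red_eq_zero`), an element `s ∉ (p) • 𝐇¹_Γ(T_pW)` — the hypothesis
`s ∉ (augIdealP p) • ⊤` of `stub_coreX9` — has NON-ZERO `Ω`-adic class `red_Ω s ∈ 𝐇¹_Ω`.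
[cite: Kato2004Asterisque, §13.8 (pp. 228–229)] -/
theorem redTower_ne_zero_of_not_mem (h : mem_pSmul_of_red_eq_zero) (hκ : κ.IsCyclotomic)
    (hγ : κ.IsTopGenerator γ) {s : I.H}
    (hs : s ∉ (IwasawaAlgebra.augIdealP p) • (⊤ : Submodule (IwasawaAlgebra p) I.H)) :
    I.redTower s ≠ 0 := fun h0 ↦
  mem_pSmul_of_red_eq_zero.red_ne_zero h hκ hγ I hs ((I.redTower_eq_zero_iff s).1 h0)

/-- Under the fact: `red_Ω x = 0 ↔ x ∈ (p) • 𝐇¹` (`ker red_Ω = p·𝐇¹_Γ(T_pW)`).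
[cite: Kato2004Asterisque, §13.8 (pp. 228–229)] -/
theorem redTower_eq_zero_iff_mem (h : mem_pSmul_of_red_eq_zero) (hκ : κ.IsCyclotomic)
    (hγ : κ.IsTopGenerator γ) (x : I.H) :
    I.redTower x = 0 ↔ x ∈ (IwasawaAlgebra.augIdealP p) • (⊤ : Submodule (IwasawaAlgebra p) I.H) := by
  rw [redTower_eq_zero_iff]
  exact mem_pSmul_of_red_eq_zero.red_eq_zero_iff h hκ hγ I x

end IwasawaH1Data

end Literature.NumberTheory.EllipticCurves.Kato2004

end
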